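import Summits.RiemannHypothesis.RiemannHypothesis.Theorems.JensenLogBandFarZoneCompetitorXi
import HarnessLib

/-!
# The far-zone competitor bound, part 2: kernel comparison and assembly (BAND crux, far-zone input F7)

RH ladder column JENSEN, rung J-P(P3) «log band», BAND crux `XiDerivBandRealAllRates`
(stmt-RiemannHypothesis-19913) of route «JensenLogBand», line «band-one-window» (u-arc reshape;
BAND lead rh-jensen-prover g8), registered stub `stub_farZone`. RH-FREE. WHAT THIS IS NOT: nothing
here bears on zeros of `ζ` or the truth of RH.

Everything on the competitor arc is compared with the OWN centre's model peak `‖I_{r*}(φ₀)‖`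
(`c = x + iT`, `u*` the saddle of S3, `r* = ‖u* − c‖`, `φ₀ = arg(u* − c)`):

* `mul_norm_sqKernel_competitor_le` (F7b): `h·‖K_{n,c₋}(u_θ)‖ ≤ e^{2h+9}·r*·‖K_{n,c}(u*)‖`
  (`(r*/h)^{n+1}·((2T+h+9)/(2T−h))^{n+1} ≤ e^{8 + 8h/5}` by F4's `r* ≤ h + ε`, `εℓ = 2 + 16h/5`);
* **`norm_arcIntegrandU_competitor_le`** (F7): for `|θ| ≤ π/2`, a competitor centre `c₋ = x' + iT`
  (`|x'| ≤ ½`, same radius `h`) whose whole right half-arc lies left of `1 + δ`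
  (`½ + x' + h ≤ 1 + δ`, `0 < δ ≤ 1`) and `1 + δ ≤ σ* = Re(½ + u*)`:
  `‖arcIntegrandU n h c₋ θ‖ ≤ 672·log(T+h)·e^{4h+9}·exp(−(σ* − 1 − δ)(ℓ_T/2 − 1))·‖I_{r*}(φ₀)‖`.
  In the far zone (`x = a`, `x' = −a`, `δ = δ₁ = 2/c − ¼`, `a > h − ½ − δ₁`) F4 gives
  `σ* ≥ ½ + a + h − ε ≥ 1 + 3δ₁ − ε`, so the exponent is `≤ −(2δ₁ − ε)(ℓ/2 − 1) ≈ −δ₁ℓ_T`, while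
  `ℓ_T ≥ 2(n+1)/(1+δ₁)` there: `‖U(−a+iT)‖ ≤ (n!/2π)·π·sup_θ ‖arcIntegrandU‖` is exponentially
  below the own main term.

Regime for the own centre: `|x| ≤ ½`, `T ≥ 100`, `ℓ_T ≥ 20`, `n ≥ 100`, `½ ≤ h ≤ (7/20)T`, `h ≤ 20`,
`u*` in the S3 disc with `S_{n,c}(u*) = 0`. (prover-rh-jensen-eng-2-g6-0, 2026-08-27.)
-/

noncomputable section

-- single-problem summit: `Summit.RiemannHypothesis.RiemannHypothesis.…` is the tree convention
set_option linter.dupNamespace false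

open Complex Real Set

namespace Summit.RiemannHypothesis.RiemannHypothesis.Theorems.JensenPolynomials.LogBandArc

open Literature.NumberTheory.LFunctions

variable {n : ℕ} {x T : ℝ} {u : ℂ}

/-! ## F7b: the competitor kernel against the own saddle kernel -/

set_option maxHeartbeats 400000 in -- long chain of explicit norm estimates in a large context, no search
/-- **Competitor kernel vs own saddle kernel:** for the competitor arc `u_θ = (x'+iT) + h e^{iθ}`
(`|x'| ≤ ½`, same radius `h = h(n,T)`) and the own saddle `u*` about `c = x + iT` (regime R2):
`h · ‖K_{n,c₋}(u_θ)‖ ≤ e^{2h + 9} · r* · ‖K_{n,c}(u*)‖`, `r* = ‖u* − c‖`. RH-FREE. [folklore] -/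
theorem mul_norm_sqKernel_competitor_le {x' : ℝ} (hx : |x| ≤ 1 / 2) (hT : 100 ≤ T)
    (hℓ : 20 ≤ ell T) (hn : 100 ≤ n) (hh : 1 / 2 ≤ bandRadius n T)
    (hhT : bandRadius n T ≤ 7 / 20 * T) (hH : bandRadius n T ≤ 20)
    (hu : ‖u - ((x : ℂ) + (T : ℂ) * I + bandRadius n T)‖ ≤ 3 / 5 * bandRadius n T)
    (hS : arcSaddleFn n ((x : ℂ) + (T : ℂ) * I) u = 0) (hx' : |x'| ≤ 1 / 2) (θ : ℝ) :
    bandRadius n T * ‖sqKernel n ((x' : ℂ) + (T : ℂ) * I)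
        (circleMap ((x' : ℂ) + (T : ℂ) * I) (bandRadius n T) θ)‖ ≤
      Real.exp (2 * bandRadius n T + 9) *
        (‖u - ((x : ℂ) + (T : ℂ) * I)‖ * ‖sqKernel n ((x : ℂ) + (T : ℂ) * I) u‖) := by
  obtain ⟨-, hεh, hε33, hT1200, hnT⟩ := R2_bookkeeping hT hℓ hh hH
  obtain ⟨hre_lo, him_abs, hr_lo, hr_hi⟩ := arcSaddle_sharp_polar hx hT hℓ hn hh hhT hH hu hS
  have hℓ0 : 0 < ell T := by linarith
  have hεℓ : (2 + 16 / 5 * bandRadius n T) / ell T * ell T = 2 + 16 / 5 * bandRadius n T :=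
    div_mul_cancel₀ _ hℓ0.ne'
  have hhℓ : bandRadius n T * ell T = 2 * ((n : ℝ) + 1) := bandRadius_mul_ell hℓ
  have hcim : ((x : ℂ) + (T : ℂ) * I).im = T := by simp
  have hcre : ((x : ℂ) + (T : ℂ) * I).re = x := by simp
  have hc'im : ((x' : ℂ) + (T : ℂ) * I).im = T := by simp
  have hc're : ((x' : ℂ) + (T : ℂ) * I).re = x' := by simp
  have hwc : ‖circleMap ((x' : ℂ) + (T : ℂ) * I) (bandRadius n T) θ - ((x' : ℂ) + (T : ℂ) * I)‖ =
      bandRadius n T := by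
    rw [circleMap_sub_center, norm_circleMap_zero, abs_of_pos (by linarith)]
  obtain ⟨hwre, hwim⟩ := circleMap_sub_re_im ((x' : ℂ) + (T : ℂ) * I) (bandRadius n T) θ
  generalize hε' : (2 + 16 / 5 * bandRadius n T) / ell T = ε at *
  generalize hh' : bandRadius n T = h at *
  generalize hℓ' : ell T = ℓ at *
  generalize hc : ((x : ℂ) + (T : ℂ) * I) = c at *
  generalize hc' : ((x' : ℂ) + (T : ℂ) * I) = c' at *
  generalize hr' : ‖u - c‖ = r at *
  generalize hw' : circleMap c' h θ = w at *
  have hx1 := abs_le.1 hx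
  have hx1' := abs_le.1 hx'
  have hh0 : 0 < h := by linarith only [hh]
  have hrlo : 16 / 25 * h ≤ r := by linarith only [hr_lo, hεh]
  have hr0 : 0 < r := by linarith only [hrlo, hh0]
  have hrhi : r ≤ h + 33 / 10 := by linarith only [hr_hi, hε33]
  have hsin := abs_le.1 (Real.abs_sin_le_one θ)
  have hcos := abs_le.1 (Real.abs_cos_le_one θ)
  -- norms of the four points
  have him_u := abs_le.1 him_abs
  have hre_u : |(u - c).re| ≤ h + 33 / 10 := by
    have := (Complex.abs_re_le_norm (u - c)).trans (le_of_eq hr')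
    exact this.trans hrhi
  have hre_u' := abs_le.1 hre_u
  have hu_norm_lo : T - 33 / 10 ≤ ‖u‖ := by
    have e : u.im = (u - c).im + T := by rw [Complex.sub_im, hcim]; ring
    have := Complex.abs_im_le_norm u
    rw [abs_of_pos (by rw [e]; linarith only [him_u.1, hε33, hT1200])] at this
    rw [e] at this; linarith only [this, him_u.1, hε33]
  have hw_norm_hi : ‖w‖ ≤ T + h + 1 / 2 := by
    have e1 : w = c' + (w - c') := by ring
    have hn_c' : ‖c'‖ ≤ 1 / 2 + T := by
      rw [← hc']
      calc ‖(x' : ℂ) + (T : ℂ) * I‖ ≤ ‖(x' : ℂ)‖ + ‖(T : ℂ) * I‖ := norm_add_le _ _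
        _ ≤ 1 / 2 + T := by
            rw [norm_mul, Complex.norm_I, mul_one, Complex.norm_real, Complex.norm_real,
              Real.norm_eq_abs, Real.norm_eq_abs, abs_of_nonneg (show (0 : ℝ) ≤ T by linarith only [hT1200])]
            linarith only [hx']
    calc ‖w‖ = ‖c' + (w - c')‖ := by rw [← e1]
      _ ≤ ‖c'‖ + ‖w - c'‖ := norm_add_le _ _
      _ ≤ T + h + 1 / 2 := by rw [hwc]; linarith only [hn_c']
  have huc_hi : ‖u + c‖ ≤ 2 * T + h + 9 := by
    have hre : |(u + c).re| ≤ h + 5 := by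
      have e : (u + c).re = (u - c).re + 2 * x := by rw [Complex.add_re, Complex.sub_re, hcre]; ring
      rw [e]; refine (abs_add_le _ _).trans ?_
      have : |2 * x| ≤ 1 := by rw [abs_le]; constructor <;> linarith only [hx1]
      linarith only [hre_u, this]
    have him : |(u + c).im| ≤ 2 * T + 33 / 10 := by
      have e : (u + c).im = (u - c).im + 2 * T := by rw [Complex.add_im, Complex.sub_im, hcim]; ring
      rw [e]; refine (abs_add_le _ _).trans ?_
      rw [abs_of_pos (by linarith only [hT1200] : (0:ℝ) < 2 * T)]
      linarith only [him_abs, hε33]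
    calc ‖u + c‖ ≤ |(u + c).re| + |(u + c).im| := Complex.norm_le_abs_re_add_abs_im _
      _ ≤ 2 * T + h + 9 := by linarith only [hre, him]
  have hwc'_lo : 2 * T - h ≤ ‖w + c'‖ := by
    have e : (w + c').im = (w - c').im + 2 * T := by rw [Complex.add_im, Complex.sub_im, hc'im]; ring
    have h1 : 2 * T - h ≤ (w + c').im := by
      rw [e, hwim]; nlinarith only [hsin.1, hh0]
    have := Complex.abs_im_le_norm (w + c')
    rw [abs_of_pos (by linarith only [h1, hT1200, hH])] at this
    linarith only [this, h1]
  have hwc'0 : 0 < ‖w + c'‖ := by linarith only [hwc'_lo, hT1200, hH]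
  -- the power ratio `(r‖u+c‖)^{n+1} ≤ e^{8 + 8h/5} (h‖w+c'‖)^{n+1}`
  have hε0 : 0 ≤ ε := (abs_nonneg _).trans him_abs
  have hεh0 : 0 ≤ ε / h := div_nonneg hε0 hh0.le
  have h49 : 0 ≤ 49 / (2 * T - 20) := div_nonneg (by norm_num) (by linarith only [hT1200])
  obtain ⟨sx, hsx⟩ : ∃ s : ℝ, s = ε / h + 49 / (2 * T - 20) + ε / h * (49 / (2 * T - 20)) := ⟨_, rfl⟩
  have hsx0 : 0 ≤ sx := by rw [hsx]; positivity
  have hbase : r * ‖u + c‖ ≤ (1 + sx) * (h * ‖w + c'‖) := by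
    have h1 : r ≤ (1 + ε / h) * h := by rw [add_mul, one_mul, div_mul_cancel₀ _ hh0.ne']; exact hr_hi
    have h2 : ‖u + c‖ ≤ (1 + 49 / (2 * T - 20)) * ‖w + c'‖ := by
      have h3 : ‖u + c‖ ≤ ‖w + c'‖ + 49 := by linarith only [huc_hi, hwc'_lo, hH]
      have h4 : (49 : ℝ) ≤ 49 / (2 * T - 20) * ‖w + c'‖ := by
        rw [div_mul_eq_mul_div, le_div_iff₀ (by linarith only [hT1200])]
        nlinarith only [hwc'_lo, hH]
      linarith only [h3, h4]
    calc r * ‖u + c‖ ≤ ((1 + ε / h) * h) * ((1 + 49 / (2 * T - 20)) * ‖w + c'‖) :=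
          mul_le_mul h1 h2 (norm_nonneg _) (by positivity)
      _ = (1 + sx) * (h * ‖w + c'‖) := by rw [hsx]; ring
  have hpow : (r * ‖u + c‖) ^ (n + 1) ≤ Real.exp (8 + 8 / 5 * h) * (h * ‖w + c'‖) ^ (n + 1) := by
    have h1' : (r * ‖u + c‖) ^ (n + 1) ≤ ((1 + sx) * (h * ‖w + c'‖)) ^ (n + 1) :=
      pow_le_pow_left₀ (by positivity) hbase (n + 1)
    have h1 : (r * ‖u + c‖) ^ (n + 1) ≤ (1 + sx) ^ (n + 1) * (h * ‖w + c'‖) ^ (n + 1) := by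
      rw [← mul_pow]; exact h1'
    have h2 : (1 + sx) ^ (n + 1) ≤ Real.exp (((n + 1 : ℕ) : ℝ) * sx) := by
      calc (1 + sx) ^ (n + 1) ≤ (Real.exp sx) ^ (n + 1) := by
            apply pow_le_pow_left₀ (by positivity)
            have := Real.add_one_le_exp sx; linarith only [this]
        _ = Real.exp (((n + 1 : ℕ) : ℝ) * sx) := by rw [← Real.exp_nat_mul]
    have h3 : ((n + 1 : ℕ) : ℝ) * sx ≤ 8 + 8 / 5 * h := by
      push_cast
      have hn1 : ((n : ℝ) + 1) = h * ℓ / 2 := by linarith only [hhℓ]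
      -- `(n+1) ε/h = ε ℓ/2 = 1 + 8h/5`
      have e1 : ((n : ℝ) + 1) * (ε / h) = 1 + 8 / 5 * h := by
        calc ((n : ℝ) + 1) * (ε / h) = (h * ℓ / 2) * (ε / h) := by rw [hn1]
          _ = (ε * ℓ) / 2 * (h / h) := by ring
          _ = (ε * ℓ) / 2 := by rw [div_self hh0.ne', mul_one]
          _ = 1 + 8 / 5 * h := by rw [hεℓ]; ring
      -- `(n+1)·49/(2T−20) ≤ 5`
      have e2 : ((n : ℝ) + 1) * (49 / (2 * T - 20)) ≤ 5 := by
        rw [mul_div_assoc', div_le_iff₀ (by linarith only [hT1200])]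
        linarith only [hnT, hT1200]
      -- the cross term
      have e3 : ((n : ℝ) + 1) * (ε / h * (49 / (2 * T - 20))) ≤ 1 := by
        rw [← mul_assoc, e1]
        have hb : 49 / (2 * T - 20) ≤ 1 / 48 := by
          rw [div_le_iff₀ (by linarith only [hT1200])]; linarith only [hT1200]
        calc (1 + 8 / 5 * h) * (49 / (2 * T - 20)) ≤ (1 + 8 / 5 * 20) * (1 / 48) :=
              mul_le_mul (by linarith only [hH]) hb h49 (by norm_num)
          _ ≤ 1 := by norm_num
      rw [hsx, mul_add, mul_add, e1]
      linarith only [e2, e3]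
    have h4 := h2.trans (Real.exp_le_exp.2 h3)
    exact h1.trans (mul_le_mul_of_nonneg_right h4 (by positivity))
  -- assemble: `h‖K'(w)‖ = 2h‖w‖/(h‖w+c'‖)^{n+1}`, `r‖K(u)‖ = 2r‖u‖/(r‖u+c‖)^{n+1}`
  rw [norm_sqKernel_eq, norm_sqKernel_eq, hwc, hr']
  have hA0' : 0 < (h * ‖w + c'‖) ^ (n + 1) := by positivity
  have huc0 : 0 < ‖u + c‖ := by
    have e : (u + c).im = (u - c).im + 2 * T := by rw [Complex.add_im, Complex.sub_im, hcim]; ring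
    have h1 : 0 < (u + c).im := by rw [e]; linarith only [him_u.1, hε33, hT1200]
    exact lt_of_lt_of_le h1 ((le_abs_self _).trans (Complex.abs_im_le_norm _))
  have hB0 : 0 < (r * ‖u + c‖) ^ (n + 1) := by positivity
  generalize hA : (h * ‖w + c'‖) ^ (n + 1) = A at hA0' hpow ⊢
  generalize hB : (r * ‖u + c‖) ^ (n + 1) = B at hB0 hpow ⊢
  -- `‖w‖ ≤ 2‖u‖·(slack)`: `‖w‖ ≤ T + h + 1/2 ≤ (T − 3.3)·(1 + 1/40) ≤ ‖u‖ e^{1/40}`... use `‖w‖ ≤ (21/20)‖u‖`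
  have hwu : ‖w‖ ≤ 21 / 20 * ‖u‖ := by nlinarith only [hw_norm_hi, hu_norm_lo, hT1200, hH]
  have hu0 : 0 ≤ ‖u‖ := norm_nonneg _
  -- `h/r ≤ 25/16`
  have hhr : h ≤ 25 / 16 * r := by linarith only [hrlo]
  have h1B : 1 / A ≤ Real.exp (8 + 8 / 5 * h) / B := by
    rw [div_le_div_iff₀ hA0' hB0, one_mul]; exact hpow
  have s1 : h * (2 * ‖w‖ / A) = 2 * (h * ‖w‖) * (1 / A) := by ring
  have s2 : 2 * (h * ‖w‖) * (1 / A) ≤ 2 * (25 / 16 * r * (21 / 20 * ‖u‖)) * (Real.exp (8 + 8 / 5 * h) / B) := by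
    have hhw : h * ‖w‖ ≤ 25 / 16 * r * (21 / 20 * ‖u‖) :=
      mul_le_mul hhr hwu (norm_nonneg _) (by positivity)
    exact mul_le_mul (by linarith only [hhw]) h1B (by positivity) (by positivity)
  have s3 : 2 * (25 / 16 * r * (21 / 20 * ‖u‖)) * (Real.exp (8 + 8 / 5 * h) / B) =
      (25 / 16 * (21 / 20) * Real.exp (8 + 8 / 5 * h)) * (r * (2 * ‖u‖ / B)) := by ring
  have s4 : 25 / 16 * (21 / 20) * Real.exp (8 + 8 / 5 * h) ≤ Real.exp (2 * h + 9) := by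
    have h1 : (25 / 16 * (21 / 20) : ℝ) ≤ Real.exp 1 := by
      have := Real.add_one_le_exp (1 : ℝ); linarith only [this]
    calc 25 / 16 * (21 / 20) * Real.exp (8 + 8 / 5 * h) ≤ Real.exp 1 * Real.exp (8 + 8 / 5 * h) :=
          mul_le_mul_of_nonneg_right h1 (Real.exp_pos _).le
      _ = Real.exp (9 + 8 / 5 * h) := by rw [← Real.exp_add]; ring_nf
      _ ≤ Real.exp (2 * h + 9) := Real.exp_le_exp.2 (by linarith only [hh0])
  rw [s1]
  refine s2.trans ?_
  rw [s3]
  exact mul_le_mul_of_nonneg_right s4 (by positivity)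

/-! ## F7: the competitor integrand against the own model peak -/

/-- **The far-zone competitor bound.** Own centre `c = x + iT` in regime R2 (`h = h(n,T) ≤ 20`) with
saddle `u*` (`r* = ‖u* − c‖`, `φ₀ = arg(u* − c)`); competitor centre `c₋ = x' + iT`, `|x'| ≤ ½`,
same radius `h`, whose whole right half-arc lies left of `1 + δ`: `½ + x' + h ≤ 1 + δ`
(`0 < δ ≤ 1`), and `1 + δ ≤ σ* = Re(½ + u*)`. Then for every `|θ| ≤ π/2`:
`‖arcIntegrandU n h c₋ θ‖ ≤ 672·log(T+h)·e^{4h+9}·exp(−(σ* − 1 − δ)(ℓ_T/2 − 1))·‖I_{r*}(φ₀)‖`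
(`I = arcModelIntegrand`). In the far zone (`x = a`, `x' = −a`, `δ = δ₁ = 2/c − ¼`,
`a > h − ½ − δ₁`) F4 gives `σ* ≥ ½ + a + h − ε ≥ 1 + 3δ₁ − ε`, so the exponent is `≤ −(2δ₁ − ε)(ℓ/2 − 1)`.
RH-FREE. [folklore] -/
theorem norm_arcIntegrandU_competitor_le {x' δ : ℝ} (hx : |x| ≤ 1 / 2) (hT : 100 ≤ T)
    (hℓ : 20 ≤ ell T) (hn : 100 ≤ n) (hh : 1 / 2 ≤ bandRadius n T)
    (hhT : bandRadius n T ≤ 7 / 20 * T) (hH : bandRadius n T ≤ 20)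
    (hu : ‖u - ((x : ℂ) + (T : ℂ) * I + bandRadius n T)‖ ≤ 3 / 5 * bandRadius n T)
    (hS : arcSaddleFn n ((x : ℂ) + (T : ℂ) * I) u = 0) (hx' : |x'| ≤ 1 / 2)
    (hδ : 0 < δ) (hδ1 : δ ≤ 1) (hleft : 1 / 2 + x' + bandRadius n T ≤ 1 + δ)
    (hδσ : 1 + δ ≤ (1 / 2 + u).re) {θ : ℝ} (hθ : |θ| ≤ Real.pi / 2) :
    ‖arcIntegrandU n (bandRadius n T) ((x' : ℂ) + (T : ℂ) * I) θ‖ ≤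
      672 * Real.log (T + bandRadius n T) * Real.exp (4 * bandRadius n T + 9) *
        Real.exp (-(((1 / 2 + u).re - (1 + δ)) * (ell T / 2 - 1))) *
        ‖arcModelIntegrand n ‖u - ((x : ℂ) + (T : ℂ) * I)‖ ((x : ℂ) + (T : ℂ) * I)
          (Complex.arg (u - ((x : ℂ) + (T : ℂ) * I)))‖ := by
  obtain ⟨-, -, -, hT1200, -⟩ := R2_bookkeeping hT hℓ hh hH
  have hh0 : 0 < bandRadius n T := by linarith
  have hξ := norm_xiSq_sq_competitor_le (x' := x') (h := bandRadius n T) (T := T) (δ := δ) (θ := θ)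
    hx' hh0 hH hT1200 hδ hδ1 hleft hθ
  have hγ := norm_xiGammaFactor_line_le_saddle (δ := δ) hx hT hℓ hn hh hhT hH hu hS (by linarith) hδσ
  have hK := mul_norm_sqKernel_competitor_le hx hT hℓ hn hh hhT hH hu hS hx' θ
  -- unfold the two integrands
  rw [arcIntegrandU, norm_mul, norm_mul, deriv_circleMap_eq_I_mul_sub, norm_mul, Complex.norm_I, one_mul,
    circleMap_sub_center, norm_circleMap_zero, abs_of_pos hh0, norm_arcModelIntegrand_eq,
    circleMap_norm_arg, abs_of_nonneg (norm_nonneg _)]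
  generalize hh' : bandRadius n T = h at *
  generalize hXi : ‖xiSq (circleMap ((x' : ℂ) + (T : ℂ) * I) h θ ^ 2)‖ = Xi at *
  generalize hKw : ‖sqKernel n ((x' : ℂ) + (T : ℂ) * I) (circleMap ((x' : ℂ) + (T : ℂ) * I) h θ)‖ = Kw at *
  generalize hG1 : ‖xiGammaFactor (((1 + δ : ℝ) : ℂ) + (T : ℂ) * I)‖ = G1 at *
  generalize hGs : ‖xiGammaFactor (1 / 2 + u)‖ = Gs at *
  generalize hKu : ‖sqKernel n ((x : ℂ) + (T : ℂ) * I) u‖ = Ku at *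
  generalize hr : ‖u - ((x : ℂ) + (T : ℂ) * I)‖ = r at *
  generalize hE1 : Real.exp (-(((1 / 2 + u).re - (1 + δ)) * (ell T / 2 - 1))) = E1 at *
  generalize hL : Real.log (T + h) = L at *
  have hXi0 : 0 ≤ Xi := by rw [← hXi]; exact norm_nonneg _
  have hKw0 : 0 ≤ Kw := by rw [← hKw]; exact norm_nonneg _
  have hG10 : 0 ≤ G1 := by rw [← hG1]; exact norm_nonneg _
  have hGs0 : 0 ≤ Gs := by rw [← hGs]; exact norm_nonneg _
  have hKu0 : 0 ≤ Ku := by rw [← hKu]; exact norm_nonneg _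
  have hr0 : 0 ≤ r := by rw [← hr]; exact norm_nonneg _
  have hE10 : 0 ≤ E1 := by rw [← hE1]; exact (Real.exp_pos _).le
  have hL0 : 0 ≤ L := by rw [← hL]; exact Real.log_nonneg (by linarith)
  -- `h·Xi·Kw = Xi·(h·Kw) ≤ [672 L e^{4h/5} G1]·[e^{2h+9} r Ku]` and `G1 ≤ e^{h/3} E1 Gs`
  have step1 : h * (Xi * Kw) ≤ (672 * L * Real.exp (4 / 5 * h) * G1) * (Real.exp (2 * h + 9) * (r * Ku)) := by
    have e : h * (Xi * Kw) = Xi * (h * Kw) := by ring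
    rw [e]
    exact mul_le_mul hξ hK (by positivity) (by positivity)
  have step2 : (672 * L * Real.exp (4 / 5 * h) * G1) * (Real.exp (2 * h + 9) * (r * Ku)) ≤
      (672 * L * Real.exp (4 / 5 * h) * (Real.exp (h / 3) * E1 * Gs)) * (Real.exp (2 * h + 9) * (r * Ku)) := by
    apply mul_le_mul_of_nonneg_right _ (by positivity)
    exact mul_le_mul_of_nonneg_left hγ (by positivity)
  have step3 : (672 * L * Real.exp (4 / 5 * h) * (Real.exp (h / 3) * E1 * Gs)) * (Real.exp (2 * h + 9) * (r * Ku)) =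
      672 * L * (Real.exp (4 / 5 * h) * Real.exp (h / 3) * Real.exp (2 * h + 9)) * E1 * (r * (Gs * Ku)) := by
    ring
  have step4 : Real.exp (4 / 5 * h) * Real.exp (h / 3) * Real.exp (2 * h + 9) ≤ Real.exp (4 * h + 9) := by
    rw [← Real.exp_add, ← Real.exp_add]
    exact Real.exp_le_exp.2 (by linarith)
  calc h * (Xi * Kw) ≤ _ := step1
    _ ≤ _ := step2
    _ = _ := step3
    _ ≤ 672 * L * Real.exp (4 * h + 9) * E1 * (r * (Gs * Ku)) := by
        apply mul_le_mul_of_nonneg_right _ (by positivity)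
        apply mul_le_mul_of_nonneg_right _ hE10
        exact mul_le_mul_of_nonneg_left step4 (by positivity)

end Summit.RiemannHypothesis.RiemannHypothesis.Theorems.JensenPolynomials.LogBandArc

end
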